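import Summits.ResolutionOfSingularities.ResolutionOfSingularities.Theorems.TowerCutSpreadAlg

/-!
# TowerCut (T5/8) — algebra of the first blow-up over a REGULAR local ring: `RelSimple` ⇒ regular parameters at every prime of the exceptional plane (`isRsopPart_of_relSimple`)

see `Theorems/MaxContactCutTowerCut.lean` (slice T8) for the main theorem `spreadExit_holds : SpreadExit`, the mechanism and the
sources ([Hironaka1964], [CossartJannsenSaito2020], [CutkoskyBook2004] §7).  `decomp-res-lens-2` g29, node «TowerCut».
-/

open CategoryTheory AlgebraicGeometry IsLocalRing TopologicalSpace Topology
open Literature.AlgebraicGeometry.Resolution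
open Summit.ResolutionOfSingularities.ResolutionOfSingularities.Theorems
open Summit.ResolutionOfSingularities.ResolutionOfSingularities.Theorems.WeakOrderReduction
open Summit.ResolutionOfSingularities.ResolutionOfSingularities.Theorems.DeltaFaceCutClasses
open Summit.ResolutionOfSingularities.ResolutionOfSingularities.Theorems.RelativeDeltaCut
open Summit.ResolutionOfSingularities.ResolutionOfSingularities.Theorems.SpreadCut

namespace Summit.ResolutionOfSingularities.ResolutionOfSingularities.Theorems.TowerCut

/-! ## §5 (continued)  The regular case: `(e₀, c_i)` and `(e₀, c_i, φ)` as parts of regular systems of parameters in the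
chart, and RELATIVE SIMPLICITY ⇒ the simple-point clause at every prime of the exceptional plane -/

section SpreadAlg

variable {A : Type} [CommRing A] [IsRegularLocalRing A]

/-- In the chart `c_i ≠ 0` at a prime `𝔴 ∋ e₀`: `(e₀, c_i)` is part of a regular system of parameters. [folklore] -/
theorem isRsopPart_pair_chart0 (c : Fin 3 → A) {l : ℕ} (W : Fin l → A)
    (hW : Ideal.span (Set.range (Fin.append c W)) = maximalIdeal A)
    (hd : (maximalIdeal A).spanFinrank = 3 + l) (i : Fin 3) (h0i : (0 : Fin 3) ≠ i)
    (𝔴 : PrimeSpectrum (chartRing c i)) (S : Type) [CommRing S]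
    [IsLocalRing S] [Algebra (chartRing c i) S] [IsLocalization.AtPrime S 𝔴.asIdeal]
    (h𝔴 : 𝔴.asIdeal.comap (chartBase c i) = maximalIdeal A) (h0 : chartGen c i 0 ∈ 𝔴.asIdeal) :
    IsRsopPart ![(algebraMap (chartRing c i) S : chartRing c i →+* S) (chartGen c i 0),
      (algebraMap (chartRing c i) S : chartRing c i →+* S) (chartBase c i (c i))] := by
  have jJinj : Function.Injective (fun _ : Fin 1 => (⟨0, h0i⟩ : {j : Fin 3 // j ≠ i})) :=
    fun a b _ => Subsingleton.elim a b
  have hfam := isRsopPart_chartFamily_reesChart (c := c) (i := i) W hW hd 𝔴.asIdeal h𝔴 S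
    (fun _ : Fin 1 => ⟨0, h0i⟩) jJinj (fun _ => h0)
  have hι : Function.Injective ![Fin.succ (Fin.castAdd l (0 : Fin 1)), (0 : Fin (1 + l + 1))] := by
    intro a b h
    fin_cases a <;> fin_cases b
    · rfl
    · exact absurd h (by simp [Fin.succ_ne_zero])
    · exact absurd h.symm (by simp [Fin.succ_ne_zero])
    · rfl
  have h2 := hfam.comp _ hι
  convert h2 using 1
  funext k
  fin_cases k
  · simp [chartFamily]
  · simp [chartFamily]

/-- In the chart `c_i ≠ 0` at a prime `𝔴 ∋ e₀`: `(e₀, c_i, w_k)` is part of a regular system of parameters. [folklore] -/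
theorem isRsopPart_triple_chart0 (c : Fin 3 → A) {l : ℕ} (W : Fin l → A) (k : Fin l)
    (hW : Ideal.span (Set.range (Fin.append c W)) = maximalIdeal A)
    (hd : (maximalIdeal A).spanFinrank = 3 + l) (i : Fin 3) (h0i : (0 : Fin 3) ≠ i)
    (𝔴 : PrimeSpectrum (chartRing c i)) (S : Type) [CommRing S]
    [IsLocalRing S] [Algebra (chartRing c i) S] [IsLocalization.AtPrime S 𝔴.asIdeal]
    (h𝔴 : 𝔴.asIdeal.comap (chartBase c i) = maximalIdeal A) (h0 : chartGen c i 0 ∈ 𝔴.asIdeal) :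
    IsRsopPart ![(algebraMap (chartRing c i) S : chartRing c i →+* S) (chartGen c i 0),
      (algebraMap (chartRing c i) S : chartRing c i →+* S) (chartBase c i (c i)),
      (algebraMap (chartRing c i) S : chartRing c i →+* S) (chartBase c i (W k))] := by
  have jJinj : Function.Injective (fun _ : Fin 1 => (⟨0, h0i⟩ : {j : Fin 3 // j ≠ i})) :=
    fun a b _ => Subsingleton.elim a b
  have hfam := isRsopPart_chartFamily_reesChart (c := c) (i := i) W hW hd 𝔴.asIdeal h𝔴 S
    (fun _ : Fin 1 => ⟨0, h0i⟩) jJinj (fun _ => h0)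
  have hι : Function.Injective
      ![Fin.succ (Fin.castAdd l (0 : Fin 1)), (0 : Fin (1 + l + 1)), Fin.succ (Fin.natAdd 1 k)] := by
    intro a b h
    fin_cases a <;> fin_cases b <;>
      first
      | rfl
      | (exfalso; simp [Fin.ext_iff] at h; try omega)
  have h3 := hfam.comp _ hι
  convert h3 using 1
  funext j
  fin_cases j
  · simp [chartFamily]
  · simp [chartFamily]
  · simp [chartFamily]

open Polynomial in
set_option maxHeartbeats 800000 in
/-- **RELATIVE SIMPLICITY makes the face polynomial a transversal regular parameter of the chart.**  In the chart
`c_i ≠ 0` of the blow-up of the curve `P = (c)` at a prime `𝔴 ∋ e₀` over `𝔪_A`, for `φ ∈ A[X]` with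
`RelSimple P 𝔪_A φ`: if `φ(e_k) ∈ 𝔪_{B_𝔴}` then `(e₀, c_i, φ(e_k))` is part of a regular system of parameters of
`B_𝔴`.  (At `N = Ψ⁻¹𝔴` maximal: `N² + P·A[X]` is `N`-primary and `A[X] ↠ B/(e₀, c_i)` has kernel in `P·A[X]`; at
`N = 𝔪A[X]`: `φ = ρ + v·ψ` with `ψ(e_k)` a unit.) [cite: Matsumura1987, Thm. 14.2] [cite: StacksProject, Tag 0BIQ] -/
theorem isRsopPart_of_relSimple (c : Fin 3 → A) (v : A)
    (hW : Ideal.span (Set.range (Fin.append c ![v])) = maximalIdeal A) (hd : (maximalIdeal A).spanFinrank = 3 + 1)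
    (i k : Fin 3) (h0i : (0 : Fin 3) ≠ i) (hki : k ≠ i) (hk0 : k ≠ 0)
    (𝔴 : PrimeSpectrum (chartRing c i)) {S : Type} [CommRing S] [IsLocalRing S]
    (χ : chartRing c i →+* S) (hlocχ : @IsLocalization.AtPrime _ _ S _ χ.toAlgebra 𝔴.asIdeal _)
    (h𝔴 : 𝔴.asIdeal.comap (chartBase c i) = maximalIdeal A) (h0 : chartGen c i 0 ∈ 𝔴.asIdeal)
    (φ : A[X]) (hφ : RelSimple (Ideal.span (Set.range c)) (maximalIdeal A) φ)
    (hΦ : χ (eval₂RingHom (chartBase c i) (chartGen c i k) φ) ∈ maximalIdeal S) :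
    IsRsopPart ![χ (chartGen c i 0), χ (chartBase c i (c i)), χ (eval₂RingHom (chartBase c i) (chartGen c i k) φ)] := by
  classical
  letI := χ.toAlgebra
  haveI : IsLocalization.AtPrime S 𝔴.asIdeal := hlocχ
  have halg : ∀ b, algebraMap (chartRing c i) S b = χ b := fun b =>
    RingHom.congr_fun (RingHom.algebraMap_toAlgebra χ) b
  -- localisation facts, stated through `χ` (hoisted before any abbreviation is introduced)
  have hmem𝔴 : ∀ b : chartRing c i, χ b ∈ maximalIdeal S ↔ b ∈ 𝔴.asIdeal := fun b => by
    rw [← halg, IsLocalization.AtPrime.to_map_mem_maximal_iff S 𝔴.asIdeal]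
  have hunit : ∀ b : chartRing c i, b ∉ 𝔴.asIdeal → IsUnit (χ b) := fun b hb => by
    rw [← halg]
    exact IsLocalization.map_units S (⟨b, hb⟩ : 𝔴.asIdeal.primeCompl)
  have h𝔴χ : 𝔴.asIdeal.map χ = maximalIdeal S := by
    have h := IsLocalization.AtPrime.map_eq_maximalIdeal 𝔴.asIdeal S
    rwa [RingHom.algebraMap_toAlgebra] at h
  have hpull : ∀ (I : Ideal (chartRing c i)) (x : chartRing c i), χ x ∈ I.map χ →
      ∃ m : chartRing c i, m ∉ 𝔴.asIdeal ∧ m * x ∈ I := by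
    intro I x hx
    rw [← RingHom.algebraMap_toAlgebra χ] at hx
    obtain ⟨m, hm, hmx⟩ := exists_mul_mem_of_algebraMap_mem_map 𝔴.asIdeal.primeCompl hx
    exact ⟨m, hm, hmx⟩
  set ΨB : A[X] →+* chartRing c i := eval₂RingHom (chartBase c i) (chartGen c i k) with hΨB
  set 𝔞 : Ideal (chartRing c i) := Ideal.span {chartGen c i 0, chartBase c i (c i)} with h𝔞
  set N : Ideal A[X] := 𝔴.asIdeal.comap ΨB with hN
  haveI hNp : N.IsPrime := Ideal.IsPrime.comap _
  have hcm : ∀ j, c j ∈ maximalIdeal A := fun j => hW ▸ Ideal.subset_span ⟨Fin.castAdd 1 j, by simp⟩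
  have hvm : v ∈ maximalIdeal A := hW ▸ Ideal.subset_span ⟨Fin.natAdd 3 0, by rw [Fin.append_right]; rfl⟩
  have hP𝔪 : Ideal.span (Set.range c) ≤ maximalIdeal A :=
    Ideal.span_le.mpr (by rintro _ ⟨j, rfl⟩; exact hcm j)
  have hC𝔪N : (maximalIdeal A).map (C : A →+* A[X]) ≤ N := by
    rw [Ideal.map_le_iff_le_comap]
    intro a ha
    rw [Ideal.mem_comap, hN, Ideal.mem_comap, hΨB, coe_eval₂RingHom, eval₂_C, ← Ideal.mem_comap, h𝔴]
    exact ha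
  have hφN : φ ∈ N := by rw [hN, Ideal.mem_comap, ← hmem𝔴]; exact hΦ
  have ht𝔴 : chartBase c i (c i) ∈ 𝔴.asIdeal := by rw [← Ideal.mem_comap, h𝔴]; exact hcm i
  have h𝔞𝔴 : 𝔞 ≤ 𝔴.asIdeal := by
    rw [h𝔞, Ideal.span_le]
    rintro x hx
    rcases hx with rfl | rfl
    · exact h0
    · exact ht𝔴
  -- the frame `(e₀, t)` and `(e₀, t, v)`
  have hrs2 : IsRsopPart ![χ (chartGen c i 0), χ (chartBase c i (c i))] := by
    have h := isRsopPart_pair_chart0 c ![v] hW hd i h0i 𝔴 S h𝔴 h0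
    simpa only [halg] using h
  have hrs3 : IsRsopPart ![χ (chartGen c i 0), χ (chartBase c i (c i)), χ (chartBase c i v)] := by
    have h := isRsopPart_triple_chart0 c ![v] 0 hW hd i h0i 𝔴 S h𝔴 h0
    simpa only [halg, Matrix.cons_val_fin_one] using h
  -- `χ Ψ (P·A[X]) ⊆ (t)`
  have hu : ∀ l, χ (chartBase c i (c l)) = χ (chartBase c i (c i)) * χ (chartGen c i l) := fun l => by
    rw [← map_mul, ← reesChartBase_apply_eq_mul_chartGen c i l]
  have hPt : (Ideal.span (Set.range c)).map (C : A →+* A[X]) ≤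
      (Ideal.span {χ (chartBase c i (c i))}).comap (χ.comp ΨB) := by
    rw [Ideal.map_le_iff_le_comap, Ideal.span_le]
    rintro _ ⟨l, rfl⟩
    rw [SetLike.mem_coe, Ideal.mem_comap, Ideal.mem_comap, RingHom.comp_apply, hΨB, coe_eval₂RingHom, eval₂_C, hu l]
    exact Ideal.mul_mem_right _ _ (Ideal.mem_span_singleton_self _)
  by_cases hNeq : (maximalIdeal A).map (C : A →+* A[X]) = N
  · -- `N = 𝔪·A[X]`: `φ = ρ + ψ·v` with `ρ ∈ P·A[X]` and `ψ(e_k)` a unit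
    have h𝔪 : maximalIdeal A = Ideal.span (Set.range c) ⊔ Ideal.span {v} := by
      rw [← hW, ← Ideal.span_union]
      congr 1
      simp only [range_fin_append, Matrix.range_cons, Matrix.range_empty, Set.union_empty]
    have hφ' : φ ∈ (Ideal.span (Set.range c)).map (C : A →+* A[X]) ⊔ Ideal.span {C v} := by
      have h1 : φ ∈ (maximalIdeal A).map (C : A →+* A[X]) := by rw [hNeq]; exact hφN
      rw [h𝔪, Ideal.map_sup, Ideal.map_span _ {v}, Set.image_singleton] at h1
      exact h1
    obtain ⟨ρ, hρ, w, hw, hρw⟩ := Submodule.mem_sup.mp hφ'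
    obtain ⟨ψ, rfl⟩ := Ideal.mem_span_singleton'.mp hw
    obtain ⟨N', hN'max, hNN'⟩ := Ideal.exists_le_maximal N hNp.ne_top
    have hψN : ψ ∉ N := by
      intro hψ
      apply hφ N' hN'max (hC𝔪N.trans hNN') (hNN' hφN)
      rw [← hρw]
      refine Ideal.add_mem _ (Ideal.mem_sup_right hρ) (Ideal.mem_sup_left ?_)
      rw [pow_two]
      exact Ideal.mul_mem_mul (hNN' hψ) (hNN' (hC𝔪N (Ideal.mem_map_of_mem _ hvm)))
    have hψunit : IsUnit (χ (ΨB ψ)) :=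
      hunit _ fun h => hψN (by rw [hN, Ideal.mem_comap]; exact h)
    have hρt : χ (ΨB ρ) ∈ Ideal.span {χ (chartBase c i (c i))} := by
      have h1 := hPt hρ
      rwa [Ideal.mem_comap, RingHom.comp_apply] at h1
    obtain ⟨r, hr⟩ := Ideal.mem_span_singleton'.mp hρt
    have hΨv : ΨB (C v) = chartBase c i v := by rw [hΨB, coe_eval₂RingHom, eval₂_C]
    have hΦeq : χ (ΨB φ) = r * χ (chartBase c i (c i)) + χ (ΨB ψ) * χ (chartBase c i v) := by
      rw [← hρw, map_add, map_add, ← hr, map_mul, map_mul, hΨv]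
    obtain ⟨wu, hwu⟩ := hψunit
    have hv' : χ (chartBase c i v) = ↑wu⁻¹ * (χ (ΨB φ) - r * χ (chartBase c i (c i))) := by
      rw [hΦeq, add_sub_cancel_left, ← hwu, ← mul_assoc, Units.inv_mul, one_mul]
    refine isRsopPart_of_span_range_eq hrs3 (le_antisymm ?_ ?_)
    · rw [Ideal.span_le]
      rintro _ ⟨j, rfl⟩
      fin_cases j
      · exact Ideal.subset_span ⟨0, rfl⟩
      · exact Ideal.subset_span ⟨1, rfl⟩
      · change χ (chartBase c i v) ∈ _
        rw [hv']
        exact Ideal.mul_mem_left _ _ (Ideal.sub_mem _ (Ideal.subset_span ⟨2, rfl⟩)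
          (Ideal.mul_mem_left _ _ (Ideal.subset_span ⟨1, rfl⟩)))
    · rw [Ideal.span_le]
      rintro _ ⟨j, rfl⟩
      fin_cases j
      · exact Ideal.subset_span ⟨0, rfl⟩
      · exact Ideal.subset_span ⟨1, rfl⟩
      · change χ (ΨB φ) ∈ _
        rw [hΦeq]
        exact Ideal.add_mem _ (Ideal.mul_mem_left _ _ (Ideal.subset_span ⟨1, rfl⟩))
          (Ideal.mul_mem_left _ _ (Ideal.subset_span ⟨2, rfl⟩))
  · -- `N` is maximal: `N² + P·A[X]` is `N`-primary
    haveI hNmax : N.IsMaximal := isMaximal_of_isPrime_of_map_C_ne N hC𝔪N hNeq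
    refine isRsopPart_triple_of_not_mem hrs2 hΦ fun hmem => ?_
    have h𝔞map : Ideal.span (Set.range ![χ (chartGen c i 0), χ (chartBase c i (c i))]) ≤ 𝔞.map χ := by
      rw [Ideal.span_le]
      rintro _ ⟨j, rfl⟩
      fin_cases j
      · change χ (chartGen c i 0) ∈ _
        refine Ideal.mem_map_of_mem _ ?_
        rw [h𝔞]
        exact Ideal.subset_span (Set.mem_insert _ _)
      · change χ (chartBase c i (c i)) ∈ _
        refine Ideal.mem_map_of_mem _ ?_
        rw [h𝔞]
        exact Ideal.subset_span (Set.mem_insert_of_mem _ (Set.mem_singleton _))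
    have hmemχ : χ (ΨB φ) ∈ (𝔴.asIdeal ^ 2 ⊔ 𝔞).map χ := by
      rw [Ideal.map_sup, Ideal.map_pow, h𝔴χ]
      exact sup_le_sup_left h𝔞map _ hmem
    obtain ⟨s, hs, hsφ⟩ := hpull _ _ hmemχ
    set θ : chartRing c i →+* chartRing c i ⧸ 𝔞 := Ideal.Quotient.mk 𝔞 with hθ
    have hΞsurj : Function.Surjective (θ.comp ΨB) := mk_comp_eval₂_surjective c i k h0i hki hk0
    have hΞker : RingHom.ker (θ.comp ΨB) ≤ (Ideal.span (Set.range c)).map (C : A →+* A[X]) :=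
      ker_mk_comp_eval₂_le c (isQuasiRegular_centre c ![v] hW hd) i k h0i hki hk0
    have hcomapθ : (𝔴.asIdeal.map θ).comap θ = 𝔴.asIdeal := by
      rw [hθ, Ideal.comap_map_of_surjective _ Ideal.Quotient.mk_surjective, ← RingHom.ker_eq_comap_bot,
        Ideal.mk_ker]
      exact sup_eq_left.mpr h𝔞𝔴
    have hNΞ : (𝔴.asIdeal.map θ).comap (θ.comp ΨB) = N := by
      rw [← Ideal.comap_comap, hcomapθ]
    obtain ⟨s₀, hs₀⟩ := hΞsurj (θ s)
    have hs₀N : s₀ ∉ N := by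
      intro h
      rw [← hNΞ, Ideal.mem_comap, hs₀] at h
      have h' : s ∈ (𝔴.asIdeal.map θ).comap θ := h
      rw [hcomapθ] at h'
      exact hs h'
    have hQ : s₀ * φ ∈ N ^ 2 ⊔ (Ideal.span (Set.range c)).map (C : A →+* A[X]) := by
      have h1 : (θ.comp ΨB) (s₀ * φ) ∈ (𝔴.asIdeal ^ 2 ⊔ 𝔞).map θ := by
        rw [map_mul, hs₀, RingHom.comp_apply, ← map_mul]
        exact Ideal.mem_map_of_mem _ hsφ
      have h2 : 𝔴.asIdeal.map θ = N.map (θ.comp ΨB) := by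
        rw [← hNΞ, Ideal.map_comap_of_surjective _ hΞsurj]
      rw [Ideal.map_sup, Ideal.map_pow, hθ, Ideal.map_quotient_self, sup_bot_eq, ← hθ, h2, ← Ideal.map_pow,
        ← Ideal.mem_comap, Ideal.comap_map_of_surjective _ hΞsurj, ← RingHom.ker_eq_comap_bot] at h1
      exact sup_le_sup_left hΞker _ h1
    have hQle : N ^ 2 ⊔ (Ideal.span (Set.range c)).map (C : A →+* A[X]) ≤ N :=
      sup_le (Ideal.pow_le_self two_ne_zero) ((Ideal.map_mono hP𝔪).trans hC𝔪N)
    have hrad : (N ^ 2 ⊔ (Ideal.span (Set.range c)).map (C : A →+* A[X])).radical = N := by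
      refine le_antisymm ((Ideal.radical_mono hQle).trans (le_of_eq hNp.radical)) fun x hx => ⟨2, ?_⟩
      exact Ideal.mem_sup_left (Ideal.pow_mem_pow hx 2)
    have hprim : (N ^ 2 ⊔ (Ideal.span (Set.range c)).map (C : A →+* A[X])).IsPrimary :=
      Ideal.isPrimary_of_isMaximal_radical (by rw [hrad]; exact hNmax)
    have hQ' : φ * s₀ ∈ N ^ 2 ⊔ (Ideal.span (Set.range c)).map (C : A →+* A[X]) := by rwa [mul_comm] at hQ
    rcases (Ideal.isPrimary_iff.mp hprim).2 hQ' with h | h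
    · exact hφ N hNmax hC𝔪N hφN h
    · rw [hrad] at h
      exact hs₀N h

end SpreadAlg

end Summit.ResolutionOfSingularities.ResolutionOfSingularities.Theorems.TowerCut
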